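import Mathlib
import Summits.Ventures.HodgeRepro2.T5PadicFiniteOrderCharacters
import Summits.Ventures.HodgeRepro2.T5FiniteZerosExtension

/-!
# T5FiniteZerosExtensionInfinite — «all but finitely many ν ∈ Ξ_𝔭» is non-vacuous: infinitely many
finite-order characters survive

Cell pub-hodge-repro2, Tier 5 support (seat p7; route/T5-CHECK-G-p7.md §3 S5 / S7). S5–S7 conclude
«∫ν dm ≠ 0 for all but finitely many ν ∈ Ξ_𝔭». For the conclusion to carry weight, `Ξ_𝔭` must be
infinite — which holds over a character ring containing infinitely many `p`-power roots of unity
(`𝒪_{ℂ_p}`, `W[μ_{p^∞}]`), and fails over `W` itself (T5FiniteZerosExtension's header; T5AmiceToy).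
This file records the non-vacuity:

* `infinite_finiteOrderChars`: if `R'` has infinitely many `p`-power roots of unity, there are
  infinitely many continuous finite-order characters `ℤ_p → R'` (T5PadicFiniteOrderCharacters'
  `finiteOrderCharEquiv`, `Ξ_𝔭 ≃ μ_{p^∞}`);
* `infinite_setOf_extend_ne_zero`: for a bounded `m ≠ 0` with values in the complete DVR `A` and such an
  `R'` (a complete domain over `A`), INFINITELY MANY finite-order continuous `R'`-valued characters `ν`
  have `(m ⊗ R')(ν) ≠ 0` (the finite-order characters are infinite, the killed ones finite).

Mathlib + own T5PadicFiniteOrderCharacters, T5FiniteZerosExtension (and their imports) only.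
-/

namespace Summit.Ventures.HodgeRepro2.T5FiniteZerosExtensionInfinite

open PadicInt Filter Topology
open Summit.Ventures.HodgeRepro2
open Summit.Ventures.HodgeRepro2.T5AmiceTransform
open Summit.Ventures.HodgeRepro2.T5FiniteZerosExtension

variable {p : ℕ} [hp : Fact p.Prime]

section Chars

variable {R : Type*} [Monoid R] [TopologicalSpace R] [T2Space R]

/-- `Ξ_𝔭` is infinite over a ring with infinitely many `p`-power roots of unity:
the set of continuous finite-order characters `ℤ_p → R` is infinite. -/
theorem infinite_finiteOrderChars (h : {ζ : R | ∃ k : ℕ, ζ ^ (p ^ k) = 1}.Infinite) :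
    {κ : AddChar ℤ_[p] R | Continuous κ ∧ ∃ k : ℕ, ∀ x : ℤ_[p], κ x ^ (p ^ k) = 1}.Infinite := by
  rw [← Set.infinite_coe_iff] at h ⊢
  exact (T5PadicFiniteOrderCharacters.finiteOrderCharEquiv (p := p) (R := R)).infinite_iff.mpr h

end Chars

section Extension

variable {A : Type*} [NormedCommRing A] [Algebra ℤ_[p] A] [IsBoundedSMul ℤ_[p] A]
  [IsUltrametricDist A] [CompleteSpace A] [IsDomain A] [IsDiscreteValuationRing A]
  [IsAdicComplete (IsLocalRing.maximalIdeal A) A]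
variable {R' : Type*} [NormedCommRing R'] [Algebra ℤ_[p] R'] [IsBoundedSMul ℤ_[p] R']
  [IsUltrametricDist R'] [CompleteSpace R'] [IsLinearTopology R' R'] [IsDomain R'] [Algebra A R']

/-- NON-VACUITY of «all but finitely many ν ∈ Ξ_𝔭»: over an `R'` with infinitely many `p`-power roots of
unity, infinitely many continuous finite-order characters `ν` have `(m ⊗ R')(ν) ≠ 0`. -/
theorem infinite_setOf_extend_ne_zero (m : C(ℤ_[p], A) →ₗ[A] A) {C : ℝ}
    (hb : ∀ f, ‖m f‖ ≤ C * ‖f‖) (hφ : ∀ x : A, ‖algebraMap A R' x‖ ≤ ‖x‖)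
    (hφi : Function.Injective (algebraMap A R')) (hne : m ≠ 0)
    (hζ : {ζ : R' | ∃ k : ℕ, ζ ^ (p ^ k) = 1}.Infinite) :
    {κ : {κ : AddChar ℤ_[p] R' // Continuous κ} |
      (∃ k : ℕ, ∀ x : ℤ_[p], κ.1 x ^ (p ^ k) = 1) ∧ extend m hb hφ ⟨κ.1, κ.2⟩ ≠ 0}.Infinite := by
  -- the finite-order continuous characters, as a subset of the subtype of continuous characters
  have hinf : {κ : {κ : AddChar ℤ_[p] R' // Continuous κ} |
      ∃ k : ℕ, ∀ x : ℤ_[p], κ.1 x ^ (p ^ k) = 1}.Infinite := by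
    have h := infinite_finiteOrderChars (p := p) hζ
    intro hfin
    apply h
    have himg : {κ : AddChar ℤ_[p] R' | Continuous κ ∧ ∃ k : ℕ, ∀ x : ℤ_[p], κ x ^ (p ^ k) = 1} ⊆
        Subtype.val '' {κ : {κ : AddChar ℤ_[p] R' // Continuous κ} |
          ∃ k : ℕ, ∀ x : ℤ_[p], κ.1 x ^ (p ^ k) = 1} := by
      rintro κ ⟨hκ, hk⟩
      exact ⟨⟨κ, hκ⟩, hk, rfl⟩
    exact (hfin.image Subtype.val).subset himg
  have hzero := finite_zeroSet_extend m hb hφ hφi hne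
  refine (hinf.sdiff hzero).mono ?_
  rintro κ ⟨hk, hz⟩
  exact ⟨hk, hz⟩

end Extension

end Summit.Ventures.HodgeRepro2.T5FiniteZerosExtensionInfinite
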